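import Literature.NumberTheory.LFunctions.GranvilleSoundararajan2003
import Literature.NumberTheory.LFunctions.HallTenenbaumTheorem01
import Literature.NumberTheory.LFunctions.EulerMaclaurinZeta
import Mathlib.NumberTheory.ArithmeticFunction.Misc
import Mathlib.Analysis.SpecialFunctions.Log.Base
import Mathlib.Analysis.Complex.ExponentialBounds
import HarnessLib

/-!
# Granville–Soundararajan 2003, §7: Lemma 7.1 (untwisting `n^{iα}`), proof

Topic `NumberTheory/LFunctions`.  This file DISCHARGES the named fact
`Literature.NumberTheory.LFunctions.GranvilleSoundararajan.GranvilleSoundararajan2003_lemma71` of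
`GranvilleSoundararajan2003.lean` (A. Granville, K. Soundararajan, *Decay of mean values of
multiplicative functions*, Canad. J. Math. 55 (2003), Lemma 7.1, arXiv math/9911246 pp. 9–10):
for multiplicative `f` with `|f| ≤ 1`, `x ≥ 3` and real `α`,

  `∑_{n ≤ x} f(n) n^{iα} = x^{iα}/(1+iα) ∑_{n ≤ x} f(n) + O((x/log x) log(e+|α|) exp(∑_{p ≤ x} |1-f(p)|/p))`

with an ABSOLUTE implied constant (`GranvilleSoundararajan2003_lemma71_holds`; the constant
obtained is `90 (2 log 4 + 2B₁ + 1) e²`, `B₁` the Hall–Tenenbaum constant of the tree).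

## The printed proof and how it is followed

"Let `g` denote the multiplicative function defined by `g(p^k) = f(p^k) - f(p^{k-1})`, so that
`f(n) = ∑_{d ∣ n} g(d)`. Then (7.3) `∑_{n ≤ x} f(n) n^{iα} = ∑_{d ≤ x} g(d) d^{iα} ∑_{n ≤ x/d} n^{iα}`.
By partial summation `∑_{n ≤ z} n^{iα} = z^{1+iα}/(1+iα) + O(1+α²)`, and `= O(z)`.  We use the first
estimate in (7.3) when `d ≤ x/(1+α²)` and the second when `x/(1+α²) ≤ d ≤ x`" — giving an error
`≪ (1+α²) ∑_{d ≤ x/(1+α²)} |g(d)| + x ∑_{x/(1+α²) ≤ d ≤ x} |g(d)|/d`, which (7.1) (the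
Halberstam–Richert inequality `∑_{n ≤ x} h(n) ≤ (2x/log x) ∑_{n ≤ x} h(n)/n (1 + O(1/log x))` for
`h ≥ 0` multiplicative with `h(p^k) ≤ 2`) and its partial-summation consequence (7.2) bound by
`≪ (x/log x) log(e+|α|) ∑_{d ≤ x} |g(d)|/d ≪ (x/log x) log(e+|α|) exp(∑_{p ≤ x} |1-f(p)|/p)`;
"using the above estimate twice, once with `α` replaced by `0`, we obtain the Lemma."

We follow this with three inessential simplifications, each giving the printed statement:
* `g = f * μ` (`ArithmeticFunction` Dirichlet convolution; `g * ζ = f`, `g(p^k) = f(p^k) - f(p^{k-1})`,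
  `|g(p)| = |1 - f(p)|`, `|g(p^k)| ≤ 2`), and (7.3) is Mathlib's `ArithmeticFunction.sum_Ioc_mul_eq_sum_sum`.
  Instead of applying the estimate twice we subtract `x^{iα}/(1+iα) ∑_{n ≤ x} f(n) = x^{iα}/(1+iα) ∑_d g(d)⌊x/d⌋`
  directly, so that the `d`-th term is `g(d) (d^{iα} S_α(⌊x/d⌋) - x^{iα}⌊x/d⌋/(1+iα))`.
* The exponential sum: `‖∑_{n ≤ N} n^{iα} - N^{1+iα}/(1+iα)‖ ≤ 3(1+|α|)³` (`norm_sum_cpow_sub_le`), from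
  the tree's Euler–Maclaurin formula of order one for `ζ` (`riemannZeta_eq_eulerMaclaurin₁`, Edwards
  §6.4) at `s = -iα`, taken at `N` and at `1` and subtracted.  The paper's `O(1+α²)` is sharper, but
  only `log` of this quantity enters the final bound, so any polynomial in `|α|` gives Lemma 7.1 as
  printed (with a different absolute constant).
* (7.1) in the weak form `∑_{n ≤ y} h(n) ≤ (A+B+1)(y/log y) ∑_{n ≤ y} h(n)/n` PROVED in the tree
  (`HallTenenbaum.theorem01`, Hall–Tenenbaum *Divisors* Theorem 01, with Chebyshev's `θ(y) ≤ y log 4`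
  for `A = 2 log 4` and `B = 2B₁`), the logarithmic sum `∑_{n ≤ x} h(n)/n ≤ e² exp(∑_{p ≤ x} |1-f(p)|/p)`
  by `HallTenenbaum.sum_div_le_prod_tsum` ((0.4) of Hall–Tenenbaum), and the tail (7.2) replaced by a
  dyadic decomposition of `(x/W, x]` (`Lemma71.weighted_sum_le`); the range `W = 4(1+|α|)³ > √x` is
  trivial because then `log x < 2 log W ≪ log(e+|α|)`.

## Main results
- `Lemma71.norm_sum_cpow_sub_le` : the exponential sum `∑_{n ≤ N} n^{iα}`.
- `Lemma71.sum_mul_cpow_eq` : identity (7.3).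
- `Lemma71.sum_norm_moebius_le`, `Lemma71.sum_norm_moebius_div_le_exp` : (7.1)-type bounds for `h = |f * μ|`.
- `Lemma71.weighted_sum_le` : the bulk/tail estimate replacing (7.2).
- `GranvilleSoundararajan2003_lemma71_holds` : **Lemma 7.1**.

## References
- [GranvilleSoundararajan2003] A. Granville, K. Soundararajan, *Decay of mean values of
  multiplicative functions*, Canad. J. Math. 55 (2003), 1191–1230, §7, Lemma 7.1 and its proof
  ((7.1)–(7.3)), arXiv math/9911246 pp. 9–10.
- [HallTenenbaum1988] R. R. Hall, G. Tenenbaum, *Divisors*, CUP 1988, Theorem 01 and (0.4).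
- [Edwards1974] H. M. Edwards, *Riemann's Zeta Function*, §6.4 (1) (Euler–Maclaurin for `ζ`).

## Design choices
* No new definitions: `g` is written `f * μ`, `h` is `fun n ↦ ‖(f * μ) n‖`, and the constants are
  explicit (`K = 2 log 4 + 2 B₁ + 1`, `W = 4 (1+|α|)³`, `C = 90 K e²`).
* All helper lemmas live in the sub-namespace `…GranvilleSoundararajan.Lemma71`.
-/

noncomputable section

open Finset Complex ArithmeticFunction
open scoped ArithmeticFunction.Moebius ArithmeticFunction.zeta

namespace Literature.NumberTheory.LFunctions

namespace GranvilleSoundararajan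

namespace Lemma71

/-! ## §1. The exponential sum `∑_{n ≤ N} n^{iα}` -/

/-- `∑_{1 ≤ n < N} n^{-s}` from the Euler–Maclaurin formula of order one taken at `N` and at `1`
(the `ζ(s)` cancel): valid for `Re s > -2`, `s ≠ 1`, `N ≥ 1`. [folklore] -/
theorem sum_Ico_cpow_neg_eq {N : ℕ} (hN : 1 ≤ N) {s : ℂ} (hs : -2 < s.re) (hs1 : s ≠ 1) :
    ∑ n ∈ Ico 1 N, (n : ℂ) ^ (-s) =
      (1 / (s - 1) + 1 / 2 + s / 12 + emRem₁ 1 s)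
        - ((N : ℂ) ^ (1 - s) / (s - 1) + (N : ℂ) ^ (-s) / 2 + s * (N : ℂ) ^ (-(s + 1)) / 12
            + emRem₁ N s) := by
  have h1 := riemannZeta_eq_eulerMaclaurin₁ hN hs hs1
  have h2 := riemannZeta_eq_eulerMaclaurin₁ (N := 1) le_rfl hs hs1
  simp only [emMainZero] at h1 h2
  simp only [Finset.Ico_self, Finset.sum_empty, Nat.cast_one, one_cpow, zero_add] at h2
  linear_combination h2 - h1

/-- The Euler–Maclaurin remainder of order one on the line `Re s = 0`:
`‖R₂(N, s)‖ ≤ ‖s‖(‖s‖+1)(‖s‖+2)/96` (`|B̄₃| ≤ 1/8`, `∫_N^∞ x^{-3} dx ≤ 1/2`). [folklore] -/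
theorem norm_emRem₁_le_of_re_eq_zero {M : ℕ} (hM : 1 ≤ M) {s : ℂ} (hsre : s.re = 0) :
    ‖emRem₁ M s‖ ≤ ‖s‖ * (‖s‖ + 1) * (‖s‖ + 2) / 96 := by
  have hs' : 1 - ((3 : ℕ) : ℝ) < s.re := by rw [hsre]; norm_num
  have hJ := norm_bernoulliLogIntegral_zero_le (k := 3) (N := M) abs_bernoulliPer_three_le hM hs'
  rw [bernoulliLogIntegral_zero, hsre] at hJ
  have hM1 : (1 : ℝ) ≤ M := by exact_mod_cast hM
  have hpow : (M : ℝ) ^ (-((0 : ℝ) + ((3 : ℕ) : ℝ) - 1)) ≤ 1 :=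
    Real.rpow_le_one_of_one_le_of_nonpos hM1 (by norm_num)
  have hJ' : ‖bernoulliIntegral 3 M s‖ ≤ 1 / 16 := by
    refine hJ.trans ?_
    have e : (0 : ℝ) + ((3 : ℕ) : ℝ) - 1 = 2 := by norm_num
    rw [e] at hpow ⊢
    have h0 : 0 ≤ (M : ℝ) ^ (-(2 : ℝ)) := Real.rpow_nonneg (Nat.cast_nonneg M) _
    linarith
  have h1 : ‖s + 1‖ ≤ ‖s‖ + 1 := (norm_add_le _ _).trans (by simp)
  have h2 : ‖s + 2‖ ≤ ‖s‖ + 2 := (norm_add_le _ _).trans (by simp)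
  unfold emRem₁
  rw [norm_mul, norm_neg, norm_div, norm_mul, norm_mul]
  have h6 : ‖(6 : ℂ)‖ = 6 := by simp
  rw [h6]
  have hs0 : 0 ≤ ‖s‖ := norm_nonneg s
  calc ‖s‖ * ‖s + 1‖ * ‖s + 2‖ / 6 * ‖bernoulliIntegral 3 M s‖
      ≤ ‖s‖ * (‖s‖ + 1) * (‖s‖ + 2) / 6 * (1 / 16) := by
        refine mul_le_mul ?_ hJ' (norm_nonneg _) (by positivity)
        refine div_le_div_of_nonneg_right ?_ (by norm_num)
        exact mul_le_mul (mul_le_mul_of_nonneg_left h1 hs0) h2 (norm_nonneg _) (by positivity)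
    _ = ‖s‖ * (‖s‖ + 1) * (‖s‖ + 2) / 96 := by ring

/-- **The exponential sum `∑_{n ≤ N} n^{iα}`**: for every `N` and every real `α`,
`‖∑_{n=1}^{N} n^{iα} - N^{1+iα}/(1+iα)‖ ≤ 3 (1+|α|)³`.  (Granville–Soundararajan use
`O(1+α²)`, "by partial summation it is easy to see"; any bound polynomial in `|α|` serves the
proof of Lemma 7.1 equally.)  Proof: the Euler–Maclaurin formula of order one for `ζ`
(`riemannZeta_eq_eulerMaclaurin₁`, Edwards §6.4 (1)) at `s = -iα`, at `N` and at `1`.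
[cite: GranvilleSoundararajan2003, §7, proof of Lemma 7.1] -/
theorem norm_sum_cpow_sub_le (N : ℕ) (α : ℝ) :
    ‖∑ n ∈ Icc 1 N, (n : ℂ) ^ ((α : ℂ) * I) - (N : ℂ) ^ (1 + (α : ℂ) * I) / (1 + (α : ℂ) * I)‖
      ≤ 3 * (1 + |α|) ^ 3 := by
  have h10 : (1 : ℂ) + α * I ≠ 0 := by
    intro h; have := congrArg Complex.re h; simp at this
  rcases Nat.eq_zero_or_pos N with rfl | hN
  · simp [Complex.zero_cpow h10]
    positivity
  set s : ℂ := -(α * I) with hs_def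
  have hsre : s.re = 0 := by simp [hs_def]
  have hs : -2 < s.re := by rw [hsre]; norm_num
  have hs1 : s ≠ 1 := by
    intro h; have := congrArg Complex.re h; rw [hsre] at this; simp at this
  have hnorm_s : ‖s‖ = |α| := by simp [hs_def]
  have hs1' : s - 1 ≠ 0 := sub_ne_zero.2 hs1
  have h1s : (1 : ℂ) + α * I = 1 - s := by rw [hs_def]; ring
  have h1s' : (1 : ℂ) - s ≠ 0 := by rw [← h1s]; exact h10
  have key := sum_Ico_cpow_neg_eq hN hs hs1
  have hIcc : ∑ n ∈ Icc 1 N, (n : ℂ) ^ ((α : ℂ) * I)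
      = ∑ n ∈ Ico 1 N, (n : ℂ) ^ (-s) + (N : ℂ) ^ (-s) := by
    rw [← Finset.Ico_add_one_right_eq_Icc, Finset.sum_Ico_succ_top hN]
    simp [hs_def]
  have hE : ∑ n ∈ Icc 1 N, (n : ℂ) ^ ((α : ℂ) * I) - (N : ℂ) ^ (1 + (α : ℂ) * I) / (1 + (α : ℂ) * I)
      = (1 / (s - 1) + 1 / 2 + s / 12 + emRem₁ 1 s)
          - ((N : ℂ) ^ (-s) / 2 + s * (N : ℂ) ^ (-(s + 1)) / 12 + emRem₁ N s)
          + (N : ℂ) ^ (-s) := by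
    rw [hIcc, key, h1s]
    field_simp
    ring
  rw [hE]
  -- the individual bounds
  have hN0 : (0 : ℝ) < N := by exact_mod_cast hN
  have hN1 : (1 : ℝ) ≤ N := by exact_mod_cast hN
  have hA1 : ‖(1 : ℂ) / (s - 1)‖ ≤ 1 := by
    rw [norm_div, norm_one]
    have hre : |(s - 1).re| ≤ ‖s - 1‖ := Complex.abs_re_le_norm _
    have : (s - 1).re = -1 := by simp [hsre]
    rw [this] at hre
    norm_num at hre
    exact div_le_one_of_le₀ hre (norm_nonneg _)
  have hA2 : ‖(1 : ℂ) / 2‖ = 1 / 2 := by simp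
  have hA3 : ‖s / 12‖ = |α| / 12 := by rw [norm_div, hnorm_s]; simp
  have hR : ∀ M : ℕ, 1 ≤ M → ‖emRem₁ M s‖ ≤ |α| * (|α| + 1) * (|α| + 2) / 96 := by
    intro M hM
    have := norm_emRem₁_le_of_re_eq_zero hM hsre
    rwa [hnorm_s] at this
  have hB1 : ‖(N : ℂ) ^ (-s)‖ = 1 := by
    rw [Complex.norm_natCast_cpow_of_pos hN]
    simp [hsre]
  have hB2 : ‖s * (N : ℂ) ^ (-(s + 1)) / 12‖ ≤ |α| / 12 := by
    rw [norm_div, norm_mul, hnorm_s, Complex.norm_natCast_cpow_of_pos hN]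
    have hre : (-(s + 1)).re = -1 := by simp [hsre]
    rw [hre]
    have hle : (N : ℝ) ^ (-1 : ℝ) ≤ 1 := Real.rpow_le_one_of_one_le_of_nonpos hN1 (by norm_num)
    have h12 : ‖(12 : ℂ)‖ = 12 := by simp
    rw [h12]
    have := mul_le_mul_of_nonneg_left hle (abs_nonneg α)
    linarith
  have hα := abs_nonneg α
  calc ‖(1 / (s - 1) + 1 / 2 + s / 12 + emRem₁ 1 s)
          - ((N : ℂ) ^ (-s) / 2 + s * (N : ℂ) ^ (-(s + 1)) / 12 + emRem₁ N s) + (N : ℂ) ^ (-s)‖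
      ≤ ‖1 / (s - 1) + 1 / 2 + s / 12 + emRem₁ 1 s‖
          + ‖(N : ℂ) ^ (-s) / 2 + s * (N : ℂ) ^ (-(s + 1)) / 12 + emRem₁ N s‖ + ‖(N : ℂ) ^ (-s)‖ :=
        norm_add_le_of_le (norm_sub_le _ _) le_rfl
    _ ≤ (1 + 1 / 2 + |α| / 12 + |α| * (|α| + 1) * (|α| + 2) / 96)
          + (1 / 2 + |α| / 12 + |α| * (|α| + 1) * (|α| + 2) / 96) + 1 := by
        refine add_le_add (add_le_add ?_ ?_) hB1.le
        · refine norm_add_le_of_le (norm_add_le_of_le (norm_add_le_of_le hA1 hA2.le) hA3.le) ?_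
          exact hR 1 le_rfl
        · refine norm_add_le_of_le (norm_add_le_of_le ?_ hB2) (hR N hN)
          rw [norm_div, hB1]; simp
    _ ≤ 3 * (1 + |α|) ^ 3 := by
        nlinarith [mul_nonneg hα hα, mul_nonneg (mul_nonneg hα hα) hα]


/-! ## §2. Phases `u^{iα}` and the `d`-th term of (7.3) -/

/-- `‖u^{iα}‖ = 1` for real `u > 0`. [folklore] -/
theorem norm_ofReal_cpow_mul_I {u : ℝ} (hu : 0 < u) (α : ℝ) : ‖(u : ℂ) ^ ((α : ℂ) * I)‖ = 1 := by
  rw [Complex.norm_cpow_eq_rpow_re_of_pos hu]; simp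

/-- `‖n^{iα}‖ = 1` for natural `n ≥ 1`. [folklore] -/
theorem norm_natCast_cpow_mul_I {n : ℕ} (hn : 0 < n) (α : ℝ) : ‖(n : ℂ) ^ ((α : ℂ) * I)‖ = 1 := by
  rw [Complex.norm_natCast_cpow_of_pos hn]; simp

/-- `‖u^{iα} - v^{iα}‖ ≤ |α| · |log u - log v|` for `u, v > 0` (`|e^{iθ} - 1| ≤ |θ|`). [folklore] -/
theorem norm_cpow_mul_I_sub_le {u v : ℝ} (hu : 0 < u) (hv : 0 < v) (α : ℝ) :
    ‖(u : ℂ) ^ ((α : ℂ) * I) - (v : ℂ) ^ ((α : ℂ) * I)‖ ≤ |α| * |Real.log u - Real.log v| := by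
  have hu' : (u : ℂ) ≠ 0 := ofReal_ne_zero.mpr hu.ne'
  have hv' : (v : ℂ) ≠ 0 := ofReal_ne_zero.mpr hv.ne'
  rw [cpow_def_of_ne_zero hu', cpow_def_of_ne_zero hv', ← ofReal_log hu.le, ← ofReal_log hv.le]
  have hA : (Real.log u : ℂ) * ((α : ℂ) * I)
      = (Real.log v : ℂ) * ((α : ℂ) * I) + I * (((Real.log u - Real.log v) * α : ℝ) : ℂ) := by
    push_cast; ring
  rw [hA, Complex.exp_add, ← mul_sub_one, norm_mul, Complex.norm_exp]
  have hre : ((Real.log v : ℂ) * ((α : ℂ) * I)).re = 0 := by simp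
  rw [hre, Real.exp_zero, one_mul]
  refine (Real.norm_exp_I_mul_ofReal_sub_one_le).trans ?_
  rw [Real.norm_eq_abs, abs_mul, mul_comm]

/-- The `d`-th term of (7.3) against the main term: for `d ≥ 1` and `d N ≤ x < d (N+1)`
(i.e. `N = ⌊x/d⌋`), `‖d^{iα} ∑_{m ≤ N} m^{iα} - x^{iα} N/(1+iα)‖ ≤ 4 (1+|α|)³`
(the exponential sum at `N`, and `|(dN)^{iα} - x^{iα}| ≤ |α| log(x/(dN)) ≤ |α|/N`).
[cite: GranvilleSoundararajan2003, §7, proof of Lemma 7.1] -/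
theorem norm_term_sub_le {d N : ℕ} (hd : 1 ≤ d) {x : ℝ} (hx1 : (d : ℝ) * N ≤ x)
    (hx2 : x < d * (N + 1)) (α : ℝ) :
    ‖(d : ℂ) ^ ((α : ℂ) * I) * ∑ m ∈ Icc 1 N, (m : ℂ) ^ ((α : ℂ) * I)
        - (x : ℂ) ^ ((α : ℂ) * I) * (N : ℂ) / (1 + (α : ℂ) * I)‖ ≤ 4 * (1 + |α|) ^ 3 := by
  have hc0 : (1 : ℂ) + (α : ℂ) * I ≠ 0 := by
    intro h; have := congrArg Complex.re h; simp at this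
  have hcn : |α| ≤ ‖(1 : ℂ) + (α : ℂ) * I‖ := by
    have := Complex.abs_im_le_norm ((1 : ℂ) + (α : ℂ) * I); simpa using this
  have hα := abs_nonneg α
  have h13 : (1 : ℝ) ≤ (1 + |α|) ^ 3 := one_le_pow₀ (by linarith)
  rcases Nat.eq_zero_or_pos N with rfl | hN
  · simp; positivity
  have hN0 : (0 : ℝ) < N := by exact_mod_cast hN
  have hd0 : (0 : ℝ) < d := by exact_mod_cast hd
  have hxpos : 0 < x := lt_of_lt_of_le (by positivity) hx1
  have hNc : (N : ℂ) ≠ 0 := by exact_mod_cast hN.ne'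
  have E1 := norm_sum_cpow_sub_le N α
  -- the decomposition
  have hsplit : (d : ℂ) ^ ((α : ℂ) * I) * ∑ m ∈ Icc 1 N, (m : ℂ) ^ ((α : ℂ) * I)
        - (x : ℂ) ^ ((α : ℂ) * I) * (N : ℂ) / (1 + (α : ℂ) * I)
      = (d : ℂ) ^ ((α : ℂ) * I) * (∑ m ∈ Icc 1 N, (m : ℂ) ^ ((α : ℂ) * I)
            - (N : ℂ) ^ (1 + (α : ℂ) * I) / (1 + (α : ℂ) * I))
        + (N : ℂ) * (((d * N : ℕ) : ℂ) ^ ((α : ℂ) * I) - (x : ℂ) ^ ((α : ℂ) * I))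
            / (1 + (α : ℂ) * I) := by
    rw [Nat.cast_mul, Complex.natCast_mul_natCast_cpow, Complex.cpow_add _ _ hNc, Complex.cpow_one]
    field_simp
    ring
  rw [hsplit]
  have h1 : ‖(d : ℂ) ^ ((α : ℂ) * I) * (∑ m ∈ Icc 1 N, (m : ℂ) ^ ((α : ℂ) * I)
      - (N : ℂ) ^ (1 + (α : ℂ) * I) / (1 + (α : ℂ) * I))‖ ≤ 3 * (1 + |α|) ^ 3 := by
    rw [norm_mul, norm_natCast_cpow_mul_I hd α, one_mul]; exact E1
  -- the phase difference
  have hdN0 : (0 : ℝ) < ((d * N : ℕ) : ℝ) := by positivity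
  have hlog : |Real.log ((d * N : ℕ) : ℝ) - Real.log x| ≤ 1 / N := by
    have hle : ((d * N : ℕ) : ℝ) ≤ x := by push_cast; exact hx1
    have hlog1 : Real.log ((d * N : ℕ) : ℝ) ≤ Real.log x := Real.log_le_log hdN0 hle
    rw [abs_sub_comm, abs_of_nonneg (by linarith), ← Real.log_div hxpos.ne' hdN0.ne']
    refine (Real.log_le_sub_one_of_pos (by positivity)).trans ?_
    rw [div_sub_one hdN0.ne', div_le_div_iff₀ hdN0 hN0]
    push_cast
    nlinarith
  have h2 : ‖(N : ℂ) * (((d * N : ℕ) : ℂ) ^ ((α : ℂ) * I) - (x : ℂ) ^ ((α : ℂ) * I))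
      / (1 + (α : ℂ) * I)‖ ≤ 1 := by
    rw [norm_div, norm_mul, Complex.norm_natCast]
    have hphase : ‖((d * N : ℕ) : ℂ) ^ ((α : ℂ) * I) - (x : ℂ) ^ ((α : ℂ) * I)‖ ≤ |α| * (1 / N) := by
      have := norm_cpow_mul_I_sub_le hdN0 hxpos α
      push_cast at this hlog ⊢
      exact this.trans (mul_le_mul_of_nonneg_left hlog hα)
    calc (N : ℝ) * ‖((d * N : ℕ) : ℂ) ^ ((α : ℂ) * I) - (x : ℂ) ^ ((α : ℂ) * I)‖ / ‖(1 : ℂ) + (α : ℂ) * I‖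
        ≤ (N : ℝ) * (|α| * (1 / N)) / ‖(1 : ℂ) + (α : ℂ) * I‖ := by gcongr
      _ = |α| / ‖(1 : ℂ) + (α : ℂ) * I‖ := by field_simp
      _ ≤ 1 := div_le_one_of_le₀ hcn (norm_nonneg _)
  calc _ ≤ ‖(d : ℂ) ^ ((α : ℂ) * I) * (∑ m ∈ Icc 1 N, (m : ℂ) ^ ((α : ℂ) * I)
            - (N : ℂ) ^ (1 + (α : ℂ) * I) / (1 + (α : ℂ) * I))‖
          + ‖(N : ℂ) * (((d * N : ℕ) : ℂ) ^ ((α : ℂ) * I) - (x : ℂ) ^ ((α : ℂ) * I))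
            / (1 + (α : ℂ) * I)‖ := norm_add_le _ _
    _ ≤ 3 * (1 + |α|) ^ 3 + 1 := add_le_add h1 h2
    _ ≤ 4 * (1 + |α|) ^ 3 := by linarith

/-- The trivial bound for the `d`-th term: `‖d^{iα} ∑_{m ≤ N} m^{iα} - x^{iα} N/(1+iα)‖ ≤ 2N`
(`x > 0`). [cite: GranvilleSoundararajan2003, §7, proof of Lemma 7.1] -/
theorem norm_term_sub_le_two_mul {d N : ℕ} (hd : 1 ≤ d) {x : ℝ} (hx : 0 < x) (α : ℝ) :
    ‖(d : ℂ) ^ ((α : ℂ) * I) * ∑ m ∈ Icc 1 N, (m : ℂ) ^ ((α : ℂ) * I)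
        - (x : ℂ) ^ ((α : ℂ) * I) * (N : ℂ) / (1 + (α : ℂ) * I)‖ ≤ 2 * N := by
  have hc1 : 1 ≤ ‖(1 : ℂ) + (α : ℂ) * I‖ := by
    have := Complex.abs_re_le_norm ((1 : ℂ) + (α : ℂ) * I); simpa using this
  have hS : ‖∑ m ∈ Icc 1 N, (m : ℂ) ^ ((α : ℂ) * I)‖ ≤ N := by
    refine (norm_sum_le _ _).trans ?_
    have : ∀ m ∈ Icc 1 N, ‖(m : ℂ) ^ ((α : ℂ) * I)‖ = 1 := fun m hm =>
      norm_natCast_cpow_mul_I (Finset.mem_Icc.mp hm).1 α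
    rw [Finset.sum_congr rfl this]; simp
  have h1 : ‖(d : ℂ) ^ ((α : ℂ) * I) * ∑ m ∈ Icc 1 N, (m : ℂ) ^ ((α : ℂ) * I)‖ ≤ N := by
    rw [norm_mul, norm_natCast_cpow_mul_I hd α, one_mul]; exact hS
  have h2 : ‖(x : ℂ) ^ ((α : ℂ) * I) * (N : ℂ) / (1 + (α : ℂ) * I)‖ ≤ N := by
    rw [norm_div, norm_mul, norm_ofReal_cpow_mul_I hx, one_mul, Complex.norm_natCast]
    exact div_le_self (Nat.cast_nonneg N) hc1
  calc _ ≤ ‖(d : ℂ) ^ ((α : ℂ) * I) * ∑ m ∈ Icc 1 N, (m : ℂ) ^ ((α : ℂ) * I)‖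
          + ‖(x : ℂ) ^ ((α : ℂ) * I) * (N : ℂ) / (1 + (α : ℂ) * I)‖ := norm_sub_le _ _
    _ ≤ N + N := add_le_add h1 h2
    _ = 2 * N := by ring

/-! ## §3. `g = f * μ` and the Halberstam–Richert-type bounds for `h = |g|` -/

variable {f : ArithmeticFunction ℂ}

/-- `(f * μ) * ζ = f` (Möbius inversion). [folklore] -/
theorem mul_moebius_mul_zeta (f : ArithmeticFunction ℂ) :
    f * (μ : ArithmeticFunction ℂ) * (ζ : ArithmeticFunction ℂ) = f := by
  rw [mul_assoc, coe_moebius_mul_coe_zeta, mul_one]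

/-- `f(p^k) = ∑_{i ≤ k} g(p^i)` for `g = f * μ`. [folklore] -/
theorem apply_prime_pow_eq_sum (f : ArithmeticFunction ℂ) {p : ℕ} (hp : p.Prime) (k : ℕ) :
    f (p ^ k) = ∑ i ∈ range (k + 1), (f * (μ : ArithmeticFunction ℂ)) (p ^ i) := by
  conv_lhs => rw [← mul_moebius_mul_zeta f]
  rw [coe_mul_zeta_apply, Nat.sum_divisors_prime_pow hp]

/-- "`g(p^k) = f(p^k) - f(p^{k-1})`" for `g = f * μ`. [cite: GranvilleSoundararajan2003, §7, proof of Lemma 7.1] -/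
theorem moebius_prime_pow_succ (f : ArithmeticFunction ℂ) {p : ℕ} (hp : p.Prime) (k : ℕ) :
    (f * (μ : ArithmeticFunction ℂ)) (p ^ (k + 1)) = f (p ^ (k + 1)) - f (p ^ k) := by
  rw [apply_prime_pow_eq_sum f hp (k + 1), apply_prime_pow_eq_sum f hp k,
    Finset.sum_range_succ _ (k + 1)]
  ring

/-- `‖g(p^{k+1})‖ ≤ 2` for `1`-bounded `f`. [folklore] -/
theorem norm_moebius_prime_pow_succ_le (hfb : ∀ n, ‖f n‖ ≤ 1) {p : ℕ} (hp : p.Prime) (k : ℕ) :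
    ‖(f * (μ : ArithmeticFunction ℂ)) (p ^ (k + 1))‖ ≤ 2 := by
  rw [moebius_prime_pow_succ f hp k]
  exact (norm_sub_le _ _).trans (by linarith [hfb (p ^ (k + 1)), hfb (p ^ k)])

/-- `‖g(p)‖ = ‖1 - f(p)‖` for multiplicative `f`. [folklore] -/
theorem norm_moebius_prime (hf : f.IsMultiplicative) {p : ℕ} (hp : p.Prime) :
    ‖(f * (μ : ArithmeticFunction ℂ)) p‖ = ‖1 - f p‖ := by
  have := moebius_prime_pow_succ f hp 0
  rw [zero_add, pow_one, pow_zero, hf.map_one] at this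
  rw [this, norm_sub_rev]

/-- `h = |f * μ|` is multiplicative with `h(1) = 1`. [folklore] -/
theorem norm_moebius_one (hf : f.IsMultiplicative) : ‖(f * (μ : ArithmeticFunction ℂ)) 1‖ = 1 := by
  rw [(hf.mul isMultiplicative_moebius.intCast).map_one, norm_one]

/-- `h(mn) = h(m) h(n)` for coprime `m, n`. [folklore] -/
theorem norm_moebius_mul (hf : f.IsMultiplicative) (m n : ℕ) (hmn : Nat.Coprime m n) :
    ‖(f * (μ : ArithmeticFunction ℂ)) (m * n)‖
      = ‖(f * (μ : ArithmeticFunction ℂ)) m‖ * ‖(f * (μ : ArithmeticFunction ℂ)) n‖ := by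
  rw [(hf.mul isMultiplicative_moebius.intCast).map_mul_of_coprime hmn, norm_mul]

/-- Hypothesis (0.5) of Hall–Tenenbaum for `h`: `∑_{p ≤ y} h(p) log p ≤ 2 log 4 · y` (Chebyshev),
via the auxiliary function `min(h, 2)/2 ≤ 1`, which is `h/2` at prime powers. [folklore] -/
theorem hypA_norm_moebius (hfb : ∀ n, ‖f n‖ ≤ 1) {y : ℝ} (hy : 0 ≤ y) :
    ∑ p ∈ Nat.primesLE ⌊y⌋₊, ‖(f * (μ : ArithmeticFunction ℂ)) p‖ * Real.log p
      ≤ 2 * Real.log 4 * y := by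
  set h2 : ℕ → ℝ := fun n => min ‖(f * (μ : ArithmeticFunction ℂ)) n‖ 2 / 2 with h2_def
  have h2le : ∀ n, h2 n ≤ 1 := fun n => by
    have := min_le_right ‖(f * (μ : ArithmeticFunction ℂ)) n‖ 2
    simp only [h2_def]; linarith
  have h := HallTenenbaum.hypA_of_le_one (f := h2) h2le hy
  have e : ∀ p ∈ Nat.primesLE ⌊y⌋₊,
      ‖(f * (μ : ArithmeticFunction ℂ)) p‖ * Real.log p = 2 * (h2 p * Real.log p) := by
    intro p hp
    have hp' := Nat.prime_of_mem_primesLE hp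
    have hle : ‖(f * (μ : ArithmeticFunction ℂ)) p‖ ≤ 2 := by
      have := norm_moebius_prime_pow_succ_le hfb hp' 0
      rwa [zero_add, pow_one] at this
    simp only [h2_def, min_eq_left hle]; ring
  rw [Finset.sum_congr rfl e, ← Finset.mul_sum]
  linarith

/-- Hypothesis (0.6) of Hall–Tenenbaum for `h`: the double sums are at most `2 B₁`. [folklore] -/
theorem hypB_norm_moebius (hfb : ∀ n, ‖f n‖ ≤ 1) (Y : ℕ) :
    ∑ p ∈ Nat.primesLE Y, ∑ ν ∈ Icc 2 Y,
        ‖(f * (μ : ArithmeticFunction ℂ)) (p ^ ν)‖ / p ^ ν * Real.log (p ^ ν)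
      ≤ 2 * HallTenenbaum.B₁ := by
  set h2 : ℕ → ℝ := fun n => min ‖(f * (μ : ArithmeticFunction ℂ)) n‖ 2 / 2 with h2_def
  have h2le : ∀ n, h2 n ≤ 1 := fun n => by
    have := min_le_right ‖(f * (μ : ArithmeticFunction ℂ)) n‖ 2
    simp only [h2_def]; linarith
  have h := HallTenenbaum.hypB_of_le_one (f := h2) h2le Y
  have e : ∀ p ∈ Nat.primesLE Y,
      ∑ ν ∈ Icc 2 Y, ‖(f * (μ : ArithmeticFunction ℂ)) (p ^ ν)‖ / p ^ ν * Real.log (p ^ ν)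
        = 2 * ∑ ν ∈ Icc 2 Y, h2 (p ^ ν) / p ^ ν * Real.log (p ^ ν) := by
    intro p hp
    have hp' := Nat.prime_of_mem_primesLE hp
    rw [Finset.mul_sum]
    refine Finset.sum_congr rfl fun ν hν => ?_
    obtain ⟨j, rfl⟩ : ∃ j, ν = j + 1 := ⟨ν - 1, by have := (Finset.mem_Icc.mp hν).1; omega⟩
    have hle := norm_moebius_prime_pow_succ_le hfb hp' j
    simp only [h2_def, min_eq_left hle]; ring
  rw [Finset.sum_congr rfl e, ← Finset.mul_sum]
  linarith

/-- **(7.1), weak form** — Hall–Tenenbaum Theorem 01 for `h = |f * μ|`: for `y > 1`,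
`∑_{n ≤ y} h(n) ≤ (2 log 4 + 2B₁ + 1) (y / log y) ∑_{n ≤ y} h(n)/n`.
[cite: HallTenenbaum1988, Theorem 01] -/
theorem sum_norm_moebius_le (hf : f.IsMultiplicative) (hfb : ∀ n, ‖f n‖ ≤ 1) {y : ℝ} (hy : 1 < y) :
    ∑ n ∈ Icc 1 ⌊y⌋₊, ‖(f * (μ : ArithmeticFunction ℂ)) n‖
      ≤ (2 * Real.log 4 + 2 * HallTenenbaum.B₁ + 1) * (y / Real.log y)
          * ∑ n ∈ Icc 1 ⌊y⌋₊, ‖(f * (μ : ArithmeticFunction ℂ)) n‖ / n :=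
  HallTenenbaum.theorem01 (f := fun n => ‖(f * (μ : ArithmeticFunction ℂ)) n‖)
    (norm_moebius_one hf) (norm_moebius_mul hf) (fun _ => norm_nonneg _)
    (fun _ hy => hypA_norm_moebius hfb hy) (hypB_norm_moebius hfb) hy

/-- The local factor of `h`: summable, and at most `1 + h(p)/p + 2/(p(p-1))`. [folklore] -/
theorem tsum_norm_moebius_prime_pow_div_le (hf : f.IsMultiplicative) (hfb : ∀ n, ‖f n‖ ≤ 1)
    {p : ℕ} (hp : p.Prime) :
    Summable (fun ν : ℕ => ‖(f * (μ : ArithmeticFunction ℂ)) (p ^ ν)‖ / (p : ℝ) ^ ν) ∧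
      ∑' ν : ℕ, ‖(f * (μ : ArithmeticFunction ℂ)) (p ^ ν)‖ / (p : ℝ) ^ ν
        ≤ 1 + ‖(f * (μ : ArithmeticFunction ℂ)) p‖ / p + 2 / ((p : ℝ) * (p - 1)) := by
  have hp2 : (2 : ℝ) ≤ p := by exact_mod_cast hp.two_le
  have hp0 : (0 : ℝ) < p := by linarith
  set g : ArithmeticFunction ℂ := f * (μ : ArithmeticFunction ℂ) with hg
  set r : ℝ := 1 / p with hr
  have hr0 : 0 ≤ r := by positivity
  have hr1 : r < 1 := by rw [hr, div_lt_one hp0]; linarith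
  have hle : ∀ ν, ‖g (p ^ ν)‖ / (p : ℝ) ^ ν ≤ 2 * r ^ ν := by
    intro ν
    rw [hr, div_pow, one_pow, mul_one_div]
    refine div_le_div_of_nonneg_right ?_ (by positivity)
    rcases Nat.eq_zero_or_pos ν with rfl | hν
    · rw [pow_zero, hg, norm_moebius_one hf]; norm_num
    · obtain ⟨j, rfl⟩ := Nat.exists_eq_add_of_le' hν
      exact norm_moebius_prime_pow_succ_le hfb hp j
  have hnn : ∀ ν, 0 ≤ ‖g (p ^ ν)‖ / (p : ℝ) ^ ν := fun ν => div_nonneg (norm_nonneg _) (by positivity)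
  have hgeom : Summable (fun ν : ℕ => r ^ ν) := summable_geometric_of_lt_one hr0 hr1
  have hsum : Summable (fun ν : ℕ => ‖g (p ^ ν)‖ / (p : ℝ) ^ ν) :=
    Summable.of_nonneg_of_le hnn hle (hgeom.mul_left 2)
  refine ⟨hsum, ?_⟩
  rw [hsum.tsum_eq_zero_add, ((summable_nat_add_iff 1).mpr hsum).tsum_eq_zero_add]
  simp only [pow_zero, pow_one, zero_add]
  rw [hg, norm_moebius_one hf, ← hg, div_one]
  have h2 : ∑' ν : ℕ, ‖g (p ^ (ν + 1 + 1))‖ / (p : ℝ) ^ (ν + 1 + 1) ≤ 2 * (r ^ 2 * (1 - r)⁻¹) := by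
    have hle2 : ∀ ν : ℕ, ‖g (p ^ (ν + 1 + 1))‖ / (p : ℝ) ^ (ν + 1 + 1) ≤ 2 * r ^ 2 * r ^ ν := by
      intro ν
      calc _ ≤ 2 * r ^ (ν + 1 + 1) := hle _
        _ = 2 * r ^ 2 * r ^ ν := by ring
    calc _ ≤ ∑' ν : ℕ, 2 * r ^ 2 * r ^ ν :=
          ((summable_nat_add_iff 2).mpr hsum).tsum_le_tsum hle2 (hgeom.mul_left _)
      _ = 2 * (r ^ 2 * (1 - r)⁻¹) := by rw [tsum_mul_left, tsum_geometric_of_lt_one hr0 hr1]; ring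
  have h3 : r ^ 2 * (1 - r)⁻¹ = 1 / ((p : ℝ) * (p - 1)) := by
    have hp1 : (p : ℝ) - 1 ≠ 0 := by linarith
    have e1 : (1 : ℝ) - r = (p - 1) / p := by rw [hr]; field_simp
    rw [e1, inv_div, hr, div_pow, one_pow, div_mul_div_comm, one_mul, pow_two]
    field_simp
  rw [h3] at h2
  have e4 : (2 : ℝ) * (1 / ((p : ℝ) * (p - 1))) = 2 / ((p : ℝ) * (p - 1)) := by ring
  linarith [h2, e4.le, e4.ge]

/-- **`∑_{n ≤ Y} h(n)/n ≤ exp(2 + ∑_{p ≤ Y} ‖1 - f(p)‖/p)`** for `h = |f * μ|` ((0.4) of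
Hall–Tenenbaum with the local factors of `h`; this is the step
"`∑_{d ≤ x} |g(d)|/d ≪ exp(∑_{p ≤ x} |1-f(p)|/p)`" of the paper). [cite: HallTenenbaum1988, (0.4)] -/
theorem sum_norm_moebius_div_le_exp (hf : f.IsMultiplicative) (hfb : ∀ n, ‖f n‖ ≤ 1) (Y : ℕ) :
    ∑ n ∈ Icc 1 Y, ‖(f * (μ : ArithmeticFunction ℂ)) n‖ / n
      ≤ Real.exp (2 + ∑ p ∈ Nat.primesLE Y, ‖1 - f p‖ / p) := by
  have h1 := HallTenenbaum.sum_div_le_prod_tsum (f := fun n => ‖(f * (μ : ArithmeticFunction ℂ)) n‖)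
    (norm_moebius_one hf) (norm_moebius_mul hf) (fun _ => norm_nonneg _)
    (fun p hp => (tsum_norm_moebius_prime_pow_div_le hf hfb hp).1) Y
  refine h1.trans ?_
  have h2 : ∏ p ∈ Nat.primesLE Y, ∑' ν : ℕ, ‖(f * (μ : ArithmeticFunction ℂ)) (p ^ ν)‖ / (p : ℝ) ^ ν
      ≤ ∏ p ∈ Nat.primesLE Y, Real.exp (‖1 - f p‖ / p + 2 / ((p : ℝ) * (p - 1))) := by
    refine Finset.prod_le_prod (fun p _ => tsum_nonneg fun ν => div_nonneg (norm_nonneg _)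
      (by positivity)) fun p hp => ?_
    have hp' := Nat.prime_of_mem_primesLE hp
    refine (tsum_norm_moebius_prime_pow_div_le hf hfb hp').2.trans ?_
    rw [norm_moebius_prime hf hp']
    linarith [Real.add_one_le_exp (‖1 - f p‖ / p + 2 / ((p : ℝ) * (p - 1)))]
  refine h2.trans ?_
  rw [← Real.exp_sum, Real.exp_le_exp, Finset.sum_add_distrib]
  have h4 : ∑ p ∈ Nat.primesLE Y, 2 / ((p : ℝ) * (p - 1)) ≤ 2 := by
    have := HallTenenbaum.sum_primesLE_inv_mul_pred_le_one Y
    have e : ∑ p ∈ Nat.primesLE Y, (2 : ℝ) / ((p : ℝ) * (p - 1))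
        = 2 * ∑ p ∈ Nat.primesLE Y, 1 / ((p : ℝ) * (p - 1)) := by
      rw [Finset.mul_sum]; refine Finset.sum_congr rfl fun p _ => ?_; ring
    rw [e]; linarith
  linarith

/-! ## §4. The bulk/tail estimate for a weighted sum of `h` (replacing (7.2)) -/

section Weighted

variable {h : ℕ → ℝ} {K M x : ℝ}

/-- From `∑_{n ≤ y} h(n) ≤ K (y/log y) ∑_{n ≤ y} h(n)/n` and `∑_{n ≤ x} h(n)/n ≤ M`:
`∑_{n ≤ y} h(n) ≤ K (y / log y) M` for `1 < y ≤ x`. [folklore] -/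
theorem sum_le_KM (hK : 0 ≤ K) (h0 : ∀ n, 0 ≤ h n)
    (hHR : ∀ y : ℝ, 1 < y →
      ∑ n ∈ Icc 1 ⌊y⌋₊, h n ≤ K * (y / Real.log y) * ∑ n ∈ Icc 1 ⌊y⌋₊, h n / n)
    (hMx : ∑ n ∈ Icc 1 ⌊x⌋₊, h n / n ≤ M) {y : ℝ} (hy : 1 < y) (hyx : y ≤ x) :
    ∑ n ∈ Icc 1 ⌊y⌋₊, h n ≤ K * (y / Real.log y) * M := by
  refine (hHR y hy).trans (mul_le_mul_of_nonneg_left ?_ ?_)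
  · refine le_trans ?_ hMx
    refine Finset.sum_le_sum_of_subset_of_nonneg (Finset.Icc_subset_Icc le_rfl (Nat.floor_mono hyx))
      fun n _ _ => div_nonneg (h0 n) (Nat.cast_nonneg n)
  · exact mul_nonneg hK (div_nonneg (by linarith) (Real.log_nonneg hy.le))

/-- One dyadic block: for `2^J ≤ √x` (`x ≥ 3`),
`∑_{x/2^{J+1} < d ≤ x/2^J} h(d)/d ≤ 4 K M / log x`. [folklore] -/
theorem sum_block_le (hK : 0 ≤ K) (hM : 0 ≤ M) (hx : 3 ≤ x) (h0 : ∀ n, 0 ≤ h n)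
    (hHR : ∀ y : ℝ, 1 < y →
      ∑ n ∈ Icc 1 ⌊y⌋₊, h n ≤ K * (y / Real.log y) * ∑ n ∈ Icc 1 ⌊y⌋₊, h n / n)
    (hMx : ∑ n ∈ Icc 1 ⌊x⌋₊, h n / n ≤ M) {J : ℕ} (hJ : (2 : ℝ) ^ J ≤ Real.sqrt x) :
    ∑ d ∈ Ioc ⌊x / 2 ^ (J + 1)⌋₊ ⌊x / 2 ^ J⌋₊, h d / d ≤ 4 * K * M / Real.log x := by
  have hx0 : 0 < x := by linarith
  have hx1 : 1 < x := by linarith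
  have hlogx : 0 < Real.log x := Real.log_pos hx1
  have hsqrt1 : 1 < Real.sqrt x := by
    rw [show (1 : ℝ) = Real.sqrt 1 from Real.sqrt_one.symm]
    exact Real.sqrt_lt_sqrt (by norm_num) hx1
  have h2J : (0 : ℝ) < 2 ^ J := by positivity
  set y : ℝ := x / 2 ^ J with hy_def
  -- `y ≥ √x > 1` and `log y ≥ (log x)/2`
  have hy1 : Real.sqrt x ≤ y := by
    rw [hy_def, le_div_iff₀ h2J]
    calc Real.sqrt x * 2 ^ J ≤ Real.sqrt x * Real.sqrt x :=
          mul_le_mul_of_nonneg_left hJ (Real.sqrt_nonneg x)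
      _ = x := Real.mul_self_sqrt hx0.le
  have hy1' : 1 < y := lt_of_lt_of_le hsqrt1 hy1
  have hy0 : 0 < y := by linarith
  have hlogy : Real.log x / 2 ≤ Real.log y := by
    have : Real.log (Real.sqrt x) = Real.log x / 2 := Real.log_sqrt hx0.le
    rw [← this]
    exact Real.log_le_log (by linarith) hy1
  have hlogy0 : 0 < Real.log y := by linarith
  -- `1/d ≤ 2^{J+1}/x` on the block
  have hblock : ∀ d ∈ Ioc ⌊x / 2 ^ (J + 1)⌋₊ ⌊x / 2 ^ J⌋₊, h d / d ≤ (2 ^ (J + 1) / x) * h d := by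
    intro d hd
    have hd1 : ⌊x / 2 ^ (J + 1)⌋₊ < d := (Finset.mem_Ioc.mp hd).1
    have hdx : x / 2 ^ (J + 1) < d := (Nat.floor_lt (by positivity)).mp hd1
    have hd0 : (0 : ℝ) < d := lt_of_le_of_lt (by positivity) hdx
    rw [div_eq_mul_inv, mul_comm]
    refine mul_le_mul_of_nonneg_right ?_ (h0 d)
    rw [inv_le_comm₀ hd0 (by positivity), inv_div]
    exact hdx.le
  calc ∑ d ∈ Ioc ⌊x / 2 ^ (J + 1)⌋₊ ⌊x / 2 ^ J⌋₊, h d / d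
      ≤ ∑ d ∈ Ioc ⌊x / 2 ^ (J + 1)⌋₊ ⌊x / 2 ^ J⌋₊, (2 ^ (J + 1) / x) * h d := Finset.sum_le_sum hblock
    _ = (2 ^ (J + 1) / x) * ∑ d ∈ Ioc ⌊x / 2 ^ (J + 1)⌋₊ ⌊x / 2 ^ J⌋₊, h d := by
        rw [Finset.mul_sum]
    _ ≤ (2 ^ (J + 1) / x) * ∑ d ∈ Icc 1 ⌊y⌋₊, h d := by
        refine mul_le_mul_of_nonneg_left ?_ (by positivity)
        refine Finset.sum_le_sum_of_subset_of_nonneg (fun d hd => ?_) fun n _ _ => h0 n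
        rw [Finset.mem_Ioc] at hd
        exact Finset.mem_Icc.mpr ⟨by omega, hd.2⟩
    _ ≤ (2 ^ (J + 1) / x) * (K * (y / Real.log y) * M) :=
        mul_le_mul_of_nonneg_left (sum_le_KM hK h0 hHR hMx hy1' (by
          rw [hy_def]; exact div_le_self hx0.le (one_le_pow₀ (by norm_num)))) (by positivity)
    _ = 2 * K * M / Real.log y := by
        rw [hy_def]; field_simp; ring
    _ ≤ 2 * K * M / (Real.log x / 2) := by
        refine div_le_div_of_nonneg_left (by positivity) (by positivity) hlogy
    _ = 4 * K * M / Real.log x := by field_simp; ring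

/-- The dyadic tail: for `2^J ≤ 2√x`,
`∑_{x/2^J < d ≤ x} h(d)/d ≤ J · 4KM/log x`. [folklore] -/
theorem sum_tail_le (hK : 0 ≤ K) (hM : 0 ≤ M) (hx : 3 ≤ x) (h0 : ∀ n, 0 ≤ h n)
    (hHR : ∀ y : ℝ, 1 < y →
      ∑ n ∈ Icc 1 ⌊y⌋₊, h n ≤ K * (y / Real.log y) * ∑ n ∈ Icc 1 ⌊y⌋₊, h n / n)
    (hMx : ∑ n ∈ Icc 1 ⌊x⌋₊, h n / n ≤ M) :
    ∀ J : ℕ, (2 : ℝ) ^ J ≤ 2 * Real.sqrt x →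
      ∑ d ∈ Ioc ⌊x / 2 ^ J⌋₊ ⌊x⌋₊, h d / d ≤ J * (4 * K * M / Real.log x) := by
  have hx0 : 0 < x := by linarith
  intro J
  induction J with
  | zero => intro _; simp
  | succ J ih =>
    intro hJ
    have hJ' : (2 : ℝ) ^ J ≤ Real.sqrt x := by
      rw [pow_succ] at hJ; linarith
    have hJ'' : (2 : ℝ) ^ J ≤ 2 * Real.sqrt x := by
      have := Real.sqrt_nonneg x; linarith
    have hmn : ⌊x / 2 ^ (J + 1)⌋₊ ≤ ⌊x / 2 ^ J⌋₊ := by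
      refine Nat.floor_mono ?_
      refine div_le_div_of_nonneg_left hx0.le (by positivity) ?_
      rw [pow_succ]; linarith [pow_pos (show (0:ℝ) < 2 by norm_num) J]
    have hnk : ⌊x / 2 ^ J⌋₊ ≤ ⌊x⌋₊ :=
      Nat.floor_mono (div_le_self hx0.le (one_le_pow₀ (by norm_num)))
    rw [← Finset.sum_Ioc_consecutive _ hmn hnk]
    have h1 := sum_block_le hK hM hx h0 hHR hMx hJ'
    have h2 := ih hJ''
    push_cast
    linarith

/-- **The weighted sum**: if `h ≥ 0` satisfies the Halberstam–Richert-type bound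
`∑_{n ≤ y} h(n) ≤ K (y/log y) ∑_{n ≤ y} h(n)/n` (`y > 1`), `∑_{n ≤ x} h(n)/n ≤ M`, and
`0 ≤ a(d) ≤ min(W, 2x/d)` for `d ≤ x` (`x ≥ 3`, `W, K ≥ 1`), then
`∑_{d ≤ x} h(d) a(d) ≤ K M (x/log x)(10 + 16 log W)` (bulk `d ≤ x/W` by the bound `W`, tail
`x/W < d ≤ x` dyadically by the bound `2x/d`). [folklore] -/
theorem weighted_sum_le {a : ℕ → ℝ} {W : ℝ} (hK : 1 ≤ K) (hW : 1 ≤ W) (hx : 3 ≤ x)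
    (h0 : ∀ n, 0 ≤ h n)
    (hHR : ∀ y : ℝ, 1 < y →
      ∑ n ∈ Icc 1 ⌊y⌋₊, h n ≤ K * (y / Real.log y) * ∑ n ∈ Icc 1 ⌊y⌋₊, h n / n)
    (hMx : ∑ n ∈ Icc 1 ⌊x⌋₊, h n / n ≤ M)
    (haW : ∀ d ∈ Icc 1 ⌊x⌋₊, a d ≤ W)
    (hax : ∀ d ∈ Icc 1 ⌊x⌋₊, a d ≤ 2 * x / d) :
    ∑ d ∈ Icc 1 ⌊x⌋₊, h d * a d ≤ K * M * (x / Real.log x) * (10 + 16 * Real.log W) := by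
  have hx0 : 0 < x := by linarith
  have hx1 : 1 < x := by linarith
  have hK0 : 0 ≤ K := by linarith
  have hlogx : 0 < Real.log x := Real.log_pos hx1
  have hlogW : 0 ≤ Real.log W := Real.log_nonneg hW
  have hW0 : 0 < W := by linarith
  have hM : 0 ≤ M := le_trans (Finset.sum_nonneg fun n _ => div_nonneg (h0 n) (Nat.cast_nonneg n)) hMx
  have hsqrt0 : 0 < Real.sqrt x := Real.sqrt_pos.mpr hx0
  have hsqx : Real.sqrt x * Real.sqrt x = x := Real.mul_self_sqrt hx0.le
  -- the tail weight: `h d a d ≤ 2x · h d / d`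
  have htail : ∀ d ∈ Icc 1 ⌊x⌋₊, h d * a d ≤ 2 * x * (h d / d) := by
    intro d hd
    calc h d * a d ≤ h d * (2 * x / d) := mul_le_mul_of_nonneg_left (hax d hd) (h0 d)
      _ = 2 * x * (h d / d) := by ring
  by_cases hWx : Real.sqrt x < W
  · -- trivial regime: `log x < 2 log W`
    have hlog : Real.log x ≤ 2 * Real.log W := by
      have h1 : Real.log (Real.sqrt x) ≤ Real.log W := Real.log_le_log hsqrt0 hWx.le
      rw [Real.log_sqrt hx0.le] at h1; linarith
    calc ∑ d ∈ Icc 1 ⌊x⌋₊, h d * a d ≤ ∑ d ∈ Icc 1 ⌊x⌋₊, 2 * x * (h d / d) := Finset.sum_le_sum htail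
      _ = 2 * x * ∑ d ∈ Icc 1 ⌊x⌋₊, h d / d := by rw [Finset.mul_sum]
      _ ≤ 2 * x * M := mul_le_mul_of_nonneg_left hMx (by positivity)
      _ = (1 * M * (x / Real.log x)) * (2 * Real.log x) := by field_simp
      _ ≤ (K * M * (x / Real.log x)) * (10 + 16 * Real.log W) := by
          refine mul_le_mul ?_ (by linarith) (by positivity) (by positivity)
          exact mul_le_mul_of_nonneg_right (mul_le_mul_of_nonneg_right hK hM) (by positivity)
  · rw [not_lt] at hWx
    -- split at `m = ⌊x/W⌋`
    set m : ℕ := ⌊x / W⌋₊ with hm_def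
    have hmX : m ≤ ⌊x⌋₊ := Nat.floor_mono (div_le_self hx0.le hW)
    have hsplit : ∑ d ∈ Icc 1 ⌊x⌋₊, h d * a d
        = ∑ d ∈ Ioc 0 m, h d * a d + ∑ d ∈ Ioc m ⌊x⌋₊, h d * a d := by
      rw [show Icc 1 ⌊x⌋₊ = Ioc 0 ⌊x⌋₊ from Finset.Icc_add_one_left_eq_Ioc 0 ⌊x⌋₊]
      exact (Finset.sum_Ioc_consecutive _ (Nat.zero_le m) hmX).symm
    -- bulk
    have hxW1 : 1 < x / W := by
      rw [lt_div_iff₀ hW0]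
      calc 1 * W = W := one_mul W
        _ ≤ Real.sqrt x := hWx
        _ < Real.sqrt x * Real.sqrt x := by
            have h1 : 1 < Real.sqrt x := by
              rw [show (1 : ℝ) = Real.sqrt 1 from Real.sqrt_one.symm]
              exact Real.sqrt_lt_sqrt (by norm_num) hx1
            nlinarith
        _ = x := hsqx
    have hlogxW : Real.log x / 2 ≤ Real.log (x / W) := by
      have h1 : Real.sqrt x ≤ x / W := by
        rw [le_div_iff₀ hW0]
        calc Real.sqrt x * W ≤ Real.sqrt x * Real.sqrt x :=
              mul_le_mul_of_nonneg_left hWx (Real.sqrt_nonneg x)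
          _ = x := hsqx
      have h2 := Real.log_le_log hsqrt0 h1
      rwa [Real.log_sqrt hx0.le] at h2
    have hbulk : ∑ d ∈ Ioc 0 m, h d * a d ≤ 2 * K * M * x / Real.log x := by
      have hIoc : Ioc 0 m = Icc 1 m := (Finset.Icc_add_one_left_eq_Ioc 0 m).symm
      calc ∑ d ∈ Ioc 0 m, h d * a d ≤ ∑ d ∈ Ioc 0 m, h d * W := by
            refine Finset.sum_le_sum fun d hd => mul_le_mul_of_nonneg_left (haW d ?_) (h0 d)
            rw [Finset.mem_Ioc] at hd
            exact Finset.mem_Icc.mpr ⟨by omega, hd.2.trans hmX⟩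
        _ = W * ∑ d ∈ Icc 1 m, h d := by
            rw [Finset.mul_sum, hIoc]; exact Finset.sum_congr rfl fun _ _ => mul_comm _ _
        _ ≤ W * (K * ((x / W) / Real.log (x / W)) * M) :=
            mul_le_mul_of_nonneg_left (sum_le_KM hK0 h0 hHR hMx hxW1 (div_le_self hx0.le hW)) hW0.le
        _ = K * M * x / Real.log (x / W) := by field_simp
        _ ≤ K * M * x / (Real.log x / 2) :=
            div_le_div_of_nonneg_left (by positivity) (by positivity) hlogxW
        _ = 2 * K * M * x / Real.log x := by field_simp
    -- tail: dyadic with `J = ⌊log₂ W⌋ + 1`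
    set L : ℝ := Real.logb 2 W with hL
    have hL0 : 0 ≤ L := Real.logb_nonneg (by norm_num) hW
    have hLW : L ≤ 2 * Real.log W := by
      rw [hL, Real.logb, div_le_iff₀ (Real.log_pos (by norm_num : (1:ℝ) < 2))]
      have hlog2 : (1 : ℝ) / 2 ≤ Real.log 2 := by
        have := Real.log_two_gt_d9; linarith
      nlinarith
    set J : ℕ := ⌊L⌋₊ + 1 with hJ_def
    have h2L : (2 : ℝ) ^ L = W := Real.rpow_logb (by norm_num) (by norm_num) hW0
    have hJW : W ≤ (2 : ℝ) ^ J := by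
      have h1 : L ≤ (J : ℝ) := by
        rw [hJ_def]; push_cast; exact (Nat.lt_floor_add_one L).le
      calc W = (2 : ℝ) ^ L := h2L.symm
        _ ≤ (2 : ℝ) ^ (J : ℝ) := Real.rpow_le_rpow_of_exponent_le (by norm_num) h1
        _ = (2 : ℝ) ^ J := Real.rpow_natCast 2 J
    have hJ2 : (2 : ℝ) ^ J ≤ 2 * Real.sqrt x := by
      have h1 : ((⌊L⌋₊ : ℕ) : ℝ) ≤ L := Nat.floor_le hL0
      calc (2 : ℝ) ^ J = 2 * (2 : ℝ) ^ ((⌊L⌋₊ : ℕ) : ℝ) := by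
            rw [hJ_def, pow_succ, Real.rpow_natCast]; ring
        _ ≤ 2 * (2 : ℝ) ^ L := by
            refine mul_le_mul_of_nonneg_left (Real.rpow_le_rpow_of_exponent_le (by norm_num) h1) (by norm_num)
        _ = 2 * W := by rw [h2L]
        _ ≤ 2 * Real.sqrt x := by linarith
    have hJle : (J : ℝ) ≤ 2 * Real.log W + 1 := by
      rw [hJ_def]; push_cast; linarith [Nat.floor_le hL0]
    have htailsum : ∑ d ∈ Ioc m ⌊x⌋₊, h d * a d ≤ 2 * x * ((2 * Real.log W + 1) * (4 * K * M / Real.log x)) := by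
      calc ∑ d ∈ Ioc m ⌊x⌋₊, h d * a d ≤ ∑ d ∈ Ioc m ⌊x⌋₊, 2 * x * (h d / d) := by
            refine Finset.sum_le_sum fun d hd => htail d ?_
            rw [Finset.mem_Ioc] at hd
            exact Finset.mem_Icc.mpr ⟨by omega, hd.2⟩
        _ = 2 * x * ∑ d ∈ Ioc m ⌊x⌋₊, h d / d := by rw [Finset.mul_sum]
        _ ≤ 2 * x * ∑ d ∈ Ioc ⌊x / 2 ^ J⌋₊ ⌊x⌋₊, h d / d := by
            refine mul_le_mul_of_nonneg_left ?_ (by positivity)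
            refine Finset.sum_le_sum_of_subset_of_nonneg (Finset.Ioc_subset_Ioc ?_ le_rfl)
              fun n _ _ => div_nonneg (h0 n) (Nat.cast_nonneg n)
            refine Nat.floor_mono (div_le_div_of_nonneg_left hx0.le hW0 hJW)
        _ ≤ 2 * x * (J * (4 * K * M / Real.log x)) :=
            mul_le_mul_of_nonneg_left (sum_tail_le hK0 hM hx h0 hHR hMx J hJ2) (by positivity)
        _ ≤ 2 * x * ((2 * Real.log W + 1) * (4 * K * M / Real.log x)) := by
            refine mul_le_mul_of_nonneg_left (mul_le_mul_of_nonneg_right hJle (by positivity)) (by positivity)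
    rw [hsplit]
    have e : 2 * K * M * x / Real.log x + 2 * x * ((2 * Real.log W + 1) * (4 * K * M / Real.log x))
        = K * M * (x / Real.log x) * (10 + 16 * Real.log W) := by
      field_simp; ring
    linarith [hbulk, htailsum, e.le]

end Weighted

/-! ## §5. Identity (7.3) and the proof of Lemma 7.1 -/

/-- **(7.3)**: `∑_{n ≤ X} f(n) n^{w} = ∑_{d ≤ X} g(d) d^{w} ∑_{m ≤ X/d} m^{w}` with `g = f * μ`
(`f = g * 1` and `(dm)^w = d^w m^w`). [cite: GranvilleSoundararajan2003, (7.3)] -/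
theorem sum_mul_cpow_eq (f : ArithmeticFunction ℂ) (w : ℂ) (X : ℕ) :
    ∑ n ∈ Icc 1 X, f n * (n : ℂ) ^ w
      = ∑ d ∈ Icc 1 X, (f * (μ : ArithmeticFunction ℂ)) d * (d : ℂ) ^ w
          * ∑ m ∈ Icc 1 (X / d), (m : ℂ) ^ w := by
  classical
  have hI : ∀ n : ℕ, Icc 1 n = Ioc 0 n := fun n => Finset.Icc_add_one_left_eq_Ioc 0 n
  -- the arithmetic function `P(n) = n^w` (`P(0) = 0`)
  let P : ArithmeticFunction ℂ := ⟨fun n => if n = 0 then 0 else (n : ℂ) ^ w, if_pos rfl⟩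
  have hP : ∀ {n : ℕ}, n ≠ 0 → P n = (n : ℂ) ^ w := fun hn => if_neg hn
  set g : ArithmeticFunction ℂ := f * (μ : ArithmeticFunction ℂ) with hg
  have hgz : g * (ζ : ArithmeticFunction ℂ) = f := mul_moebius_mul_zeta f
  -- `(g · P) * P = f · P` on `n ≥ 1`
  have hconv : ∀ n ∈ Ioc 0 X, (g.pmul P * P) n = f n * (n : ℂ) ^ w := by
    intro n hn
    have hn0 : n ≠ 0 := by have := (Finset.mem_Ioc.mp hn).1; omega
    rw [mul_apply]
    have key : ∀ x ∈ n.divisorsAntidiagonal, (g.pmul P) x.1 * P x.2 = g x.1 * (n : ℂ) ^ w := by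
      intro x hx
      obtain ⟨hx1, -⟩ := Nat.mem_divisorsAntidiagonal.mp hx
      have h1 : x.1 ≠ 0 := by rintro h; rw [h, zero_mul] at hx1; exact hn0 hx1.symm
      have h2 : x.2 ≠ 0 := by rintro h; rw [h, mul_zero] at hx1; exact hn0 hx1.symm
      rw [pmul_apply, hP h1, hP h2, ← hx1, Nat.cast_mul, Complex.natCast_mul_natCast_cpow]
      ring
    rw [Finset.sum_congr rfl key, ← Finset.sum_mul]
    have h3 : ∑ x ∈ n.divisorsAntidiagonal, g x.1 = ∑ i ∈ n.divisors, g i :=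
      Nat.sum_divisorsAntidiagonal fun a _ => g a
    rw [h3, ← coe_mul_zeta_apply (f := g) (x := n), hgz]
  calc ∑ n ∈ Icc 1 X, f n * (n : ℂ) ^ w = ∑ n ∈ Ioc 0 X, (g.pmul P * P) n := by
        rw [hI]; exact (Finset.sum_congr rfl hconv).symm
    _ = ∑ d ∈ Ioc 0 X, (g.pmul P) d * ∑ m ∈ Ioc 0 (X / d), P m := sum_Ioc_mul_eq_sum_sum _ _ X
    _ = ∑ d ∈ Icc 1 X, g d * (d : ℂ) ^ w * ∑ m ∈ Icc 1 (X / d), (m : ℂ) ^ w := by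
        rw [hI]
        refine Finset.sum_congr rfl fun d hd => ?_
        have hd0 : d ≠ 0 := by have := (Finset.mem_Ioc.mp hd).1; omega
        rw [pmul_apply, hP hd0, hI]
        congr 1
        refine Finset.sum_congr rfl fun m hm => hP ?_
        have := (Finset.mem_Ioc.mp hm).1; omega

/-- `∑_{n ≤ X} f(n) = ∑_{d ≤ X} g(d) ⌊X/d⌋` with `g = f * μ`. [folklore] -/
theorem sum_eq_sum_moebius_mul_div (f : ArithmeticFunction ℂ) (X : ℕ) :
    ∑ n ∈ Icc 1 X, f n = ∑ d ∈ Icc 1 X, (f * (μ : ArithmeticFunction ℂ)) d * ((X / d : ℕ) : ℂ) := by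
  rw [show Icc 1 X = Ioc 0 X from Finset.Icc_add_one_left_eq_Ioc 0 X]
  conv_lhs => rw [← mul_moebius_mul_zeta f]
  exact sum_Ioc_mul_zeta_eq_sum _ X

/-- `log(4 (1+|α|)³)`-bookkeeping: `10 + 16 log(4(1+|α|)³) ≤ 90 log(e + |α|)`. [folklore] -/
theorem ten_add_log_W_le (α : ℝ) :
    10 + 16 * Real.log (4 * (1 + |α|) ^ 3) ≤ 90 * Real.log (Real.exp 1 + |α|) := by
  have hα := abs_nonneg α
  have h1 : Real.log (4 * (1 + |α|) ^ 3) = Real.log 4 + 3 * Real.log (1 + |α|) := by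
    rw [Real.log_mul (by norm_num) (by positivity), Real.log_pow]; push_cast; ring
  have hL1 : 1 ≤ Real.log (Real.exp 1 + |α|) := by
    rw [← Real.log_exp 1]
    exact Real.log_le_log (Real.exp_pos 1) (by rw [Real.log_exp]; linarith)
  have hL2 : Real.log (1 + |α|) ≤ Real.log (Real.exp 1 + |α|) := by
    refine Real.log_le_log (by linarith) ?_
    have : (1 : ℝ) ≤ Real.exp 1 := by have := Real.add_one_le_exp (1 : ℝ); linarith
    linarith
  have hL0 : 0 ≤ Real.log (1 + |α|) := Real.log_nonneg (by linarith)
  have h4 : Real.log 4 ≤ 2 := by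
    have : Real.log 4 = 2 * Real.log 2 := by
      rw [show (4 : ℝ) = 2 ^ 2 by norm_num, Real.log_pow]; push_cast; ring
    rw [this]; linarith [Real.log_two_lt_d9]
  rw [h1]
  nlinarith

/-- **Granville–Soundararajan 2003, Lemma 7.1** (discharge of the named fact
`GranvilleSoundararajan2003_lemma71`): for multiplicative `f` with `|f(n)| ≤ 1`, `x ≥ 3` and real `α`,
`‖∑_{n ≤ x} f(n) n^{iα} - x^{iα}/(1+iα) ∑_{n ≤ x} f(n)‖ ≤ C (x/log x) log(e+|α|) exp(∑_{p ≤ x} |1-f(p)|/p)`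
with the absolute constant `C = 90 (2 log 4 + 2B₁ + 1) e²`.
[cite: GranvilleSoundararajan2003, Lemma 7.1] -/
theorem _root_.Literature.NumberTheory.LFunctions.GranvilleSoundararajan.GranvilleSoundararajan2003_lemma71_holds :
    GranvilleSoundararajan2003_lemma71 := by
  refine ⟨90 * (2 * Real.log 4 + 2 * HallTenenbaum.B₁ + 1) * Real.exp 2, ?_⟩
  intro f hf hfb x hx α
  -- notation
  have hx0 : 0 < x := by linarith
  have hK1 : (1 : ℝ) ≤ 2 * Real.log 4 + 2 * HallTenenbaum.B₁ + 1 := by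
    have := HallTenenbaum.B₁_nonneg
    have : 0 ≤ Real.log 4 := Real.log_nonneg (by norm_num)
    linarith
  have hα := abs_nonneg α
  have hW1 : (1 : ℝ) ≤ 4 * (1 + |α|) ^ 3 := by
    have : (1 : ℝ) ≤ (1 + |α|) ^ 3 := one_le_pow₀ (by linarith)
    linarith
  set X : ℕ := ⌊x⌋₊ with hX
  set g : ArithmeticFunction ℂ := f * (μ : ArithmeticFunction ℂ) with hg
  -- the `d`-th term
  set A : ℕ → ℂ := fun d => (d : ℂ) ^ ((α : ℂ) * I) * ∑ m ∈ Icc 1 (X / d), (m : ℂ) ^ ((α : ℂ) * I)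
      - (x : ℂ) ^ ((α : ℂ) * I) * ((X / d : ℕ) : ℂ) / (1 + (α : ℂ) * I) with hA
  -- Step 1: `T = ∑_d g(d) A(d)`
  have hT : ∑ n ∈ Icc 1 X, f n * (n : ℂ) ^ ((α : ℂ) * I)
        - (x : ℂ) ^ ((α : ℂ) * I) / (1 + (α : ℂ) * I) * ∑ n ∈ Icc 1 X, f n
      = ∑ d ∈ Icc 1 X, g d * A d := by
    rw [sum_mul_cpow_eq f _ X, sum_eq_sum_moebius_mul_div f X, Finset.mul_sum,
      ← Finset.sum_sub_distrib]
    refine Finset.sum_congr rfl fun d _ => ?_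
    simp only [hA, hg]
    ring
  -- Step 2: `‖T‖ ≤ ∑_d h(d) ‖A(d)‖`
  have hT2 : ‖∑ d ∈ Icc 1 X, g d * A d‖ ≤ ∑ d ∈ Icc 1 X, ‖g d‖ * ‖A d‖ := by
    refine (norm_sum_le _ _).trans ?_
    exact Finset.sum_le_sum fun d _ => (norm_mul _ _).le
  -- Step 3: the weighted-sum lemma
  have hdiv : ∀ d ∈ Icc 1 X, (d : ℝ) * ((X / d : ℕ) : ℝ) ≤ x ∧ x < d * (((X / d : ℕ) : ℝ) + 1) := by
    intro d hd
    have hd1 : 1 ≤ d := (Finset.mem_Icc.mp hd).1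
    have hXx : (X : ℝ) ≤ x := Nat.floor_le hx0.le
    have hxX : x < X + 1 := Nat.lt_floor_add_one x
    constructor
    · have h1 : ((X / d * d : ℕ) : ℝ) ≤ X := by exact_mod_cast Nat.div_mul_le_self X d
      push_cast at h1
      linarith
    · have h2 : ((X : ℕ) : ℝ) < ((X / d * d + d : ℕ) : ℝ) := by exact_mod_cast Nat.lt_div_mul_add hd1
      have h3 : (X : ℝ) + 1 ≤ ((X / d * d + d : ℕ) : ℝ) := by
        have : X + 1 ≤ X / d * d + d := Nat.lt_div_mul_add hd1
        exact_mod_cast this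
      push_cast at h3
      nlinarith
  have haW : ∀ d ∈ Icc 1 X, ‖A d‖ ≤ 4 * (1 + |α|) ^ 3 := by
    intro d hd
    have hd1 : 1 ≤ d := (Finset.mem_Icc.mp hd).1
    obtain ⟨h1, h2⟩ := hdiv d hd
    exact norm_term_sub_le hd1 h1 h2 α
  have hax : ∀ d ∈ Icc 1 X, ‖A d‖ ≤ 2 * x / d := by
    intro d hd
    have hd1 : 1 ≤ d := (Finset.mem_Icc.mp hd).1
    have hd0 : (0 : ℝ) < d := by exact_mod_cast hd1
    refine (norm_term_sub_le_two_mul hd1 hx0 α).trans ?_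
    obtain ⟨h1, -⟩ := hdiv d hd
    rw [le_div_iff₀ hd0]
    nlinarith
  have hHR := fun (y : ℝ) (hy : 1 < y) => sum_norm_moebius_le hf hfb hy
  have hMx := sum_norm_moebius_div_le_exp hf hfb X
  have hmain := weighted_sum_le (h := fun n => ‖g n‖) (a := fun d => ‖A d‖) hK1 hW1 hx
    (fun _ => norm_nonneg _) hHR hMx haW hax
  -- Step 4: constants
  have hlogx : 0 < Real.log x := Real.log_pos (by linarith)
  have hM0 : 0 < Real.exp (2 + ∑ p ∈ Nat.primesLE X, ‖1 - f p‖ / p) := Real.exp_pos _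
  have hCW := ten_add_log_W_le α
  have hprimes : Nat.primesBelow (X + 1) = Nat.primesLE X := rfl
  rw [hT, hprimes]
  refine hT2.trans (hmain.trans ?_)
  rw [Real.exp_add]
  have hpos : 0 ≤ (2 * Real.log 4 + 2 * HallTenenbaum.B₁ + 1)
      * (Real.exp 2 * Real.exp (∑ p ∈ Nat.primesLE X, ‖1 - f p‖ / p)) * (x / Real.log x) := by
    positivity
  calc (2 * Real.log 4 + 2 * HallTenenbaum.B₁ + 1)
        * (Real.exp 2 * Real.exp (∑ p ∈ Nat.primesLE X, ‖1 - f p‖ / ↑p)) * (x / Real.log x)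
        * (10 + 16 * Real.log (4 * (1 + |α|) ^ 3))
      ≤ (2 * Real.log 4 + 2 * HallTenenbaum.B₁ + 1)
        * (Real.exp 2 * Real.exp (∑ p ∈ Nat.primesLE X, ‖1 - f p‖ / ↑p)) * (x / Real.log x)
        * (90 * Real.log (Real.exp 1 + |α|)) := mul_le_mul_of_nonneg_left hCW hpos
    _ = 90 * (2 * Real.log 4 + 2 * HallTenenbaum.B₁ + 1) * Real.exp 2 * (x / Real.log x)
        * Real.log (Real.exp 1 + |α|) * Real.exp (∑ p ∈ Nat.primesLE X, ‖1 - f p‖ / ↑p) := by ring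

end Lemma71

end GranvilleSoundararajan

end Literature.NumberTheory.LFunctions
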